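import Summits.ResolutionOfSingularities.ResolutionOfSingularities.Theses.FrobeniusClosing

/-!
# `BoundedMilnor` — negative lemma: dimension one carries no run at all (the hypothesis is empty)

Support (negative) lemma for crux `stmt-ResolutionOfSingularities-16346`
(`Summit.ResolutionOfSingularities.ResolutionOfSingularities.Theses.FrobeniusClosing.BoundedMilnor`,
route `FrobeniusClosing`), filed by the standing disprover (cdisprove cycle 1; work file
`Cruxes/BoundedMilnor/Disproof.lean`, paper analysis `Cruxes/BoundedMilnor/PROOF-T.md`).
No definition is declared; the statements are the route's `let`-telescope verbatim with `n`
specialised to `1`; no declaration concludes a route decl positively.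

Finding recorded here (the formal shadow of the cycle's main result): the HYPOTHESIS of
`BoundedMilnor` — an infinite run with `Isol ∧ MultP` at every step — has no model in dimension
`n = 1`, for every `p` and every field, and already its `MultP` half alone has none
(`noMultPRun_dim_one`: with one variable the blow-up chart and the Taylor shift are the identity on
coefficients and each multiplicity-`p` step divides by `u^p`, so the cleaned coefficient at exponent
`b + p·m` of `c₀` is the cleaned coefficient at `b` of the `m`-th state; taking `b = a₀ mod p`,
`m = a₀ / p` for a non-zero cleaned exponent `a₀` of `c₀` contradicts `MultP` at step `m`).  Hence
`BoundedMilnor` is vacuously true at `n = 1` (`boundedMilnor_hypothesis_empty_dim_one`), and a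
refutation needs `n ≥ 2`.  The companion paper argument (`PROOF-T.md`) shows much more — for every
prime `p ≥ 3` and every `n` the hypothesis is empty (orders stay `p`; centres are vertices of the
tangent form; its rank never drops; a vertex space of dimension `≥ 3` makes the blown-up point
non-isolated; dimension `1` frees all later centres onto a smooth formal arc `Γ` with `a ∈ I_Γ^p`;
dimension `2` dies in two steps by an `(α, β)` coefficient dichotomy) — so the crux cannot be refuted
at odd `p`; that argument is not formalised here.

Relation to the sibling crux's lane: `Theorems/ClosingReduction/Negative/DimensionOne.lean` proves the
`n = 1` body of the TARGET (`isolatedForcedTermination_dim_one`, hypothesis `Isol ∧ MultP`); the lemma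
below drops `Isol` as well and is self-contained.

## Sources
* H. Hauser, S. Perlega, *Cycles of singularities appearing in the resolution problem in positive
  characteristic*, J. Algebraic Geom. 28 (2019) = arXiv:1802.05010, p. 3 (no forced cycles known).
-/

set_option linter.dupNamespace false -- mandated namespace of this single-conjunct summit

namespace Summit.ResolutionOfSingularities.ResolutionOfSingularities.Theorems.BoundedMilnor.Negative

/-- **No multiplicity-`p` run exists in dimension one.** The `MultP` half of the hypothesis of
`BoundedMilnor` (route `let`-telescope verbatim, `n := 1`) fails at step `a₀ / p`, where `a₀` is any
exponent with non-zero cleaned coefficient in `c₀`: the one-variable dynamics is `b ↦ b + p` on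
exponents (`hshift`), so that coefficient reappears at exponent `a₀ mod p < p`. Neither `Isol`, nor the
characteristic, nor perfectness is used. [folklore] -/
theorem noMultPRun_dim_one (p : ℕ) (hp : p.Prime) (κ : Type) [Field κ]
    (c₀ : (Fin 1 → ℕ) → κ) (i : ℕ → Fin 1) (t : ℕ → Fin 1 → κ) :
    let clean : ((Fin 1 → ℕ) → κ) → ((Fin 1 → ℕ) → κ) := fun c A => @ite κ (∀ j, p ∣ A j) (Classical.dec _) 0 (c A); let bl : Fin 1 → ((Fin 1 → ℕ) → κ) → ((Fin 1 → ℕ) → κ) := fun i c B => @ite κ (Finset.sum (Finset.univ.erase i) (fun j => B j) ≤ B i) (Classical.dec _) (c (Function.update B i (B i - Finset.sum (Finset.univ.erase i) (fun j => B j)))) 0; let ord : ((Fin 1 → ℕ) → κ) → ℕ := fun c => sInf {m : ℕ | ∃ A, c A ≠ 0 ∧ m = Finset.sum Finset.univ (fun j => A j)}; let dv : Fin 1 → ℕ → ((Fin 1 → ℕ) → κ) → ((Fin 1 → ℕ) → κ) := fun i s c B => c (Function.update B i (B i + s)); let tr : Fin 1 → (Fin 1 → κ) → ℕ → ((Fin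 1 → ℕ) → κ) → ((Fin 1 → ℕ) → κ) := fun i τ s c B => Finset.sum (Fintype.piFinset (fun _ : Fin 1 => Finset.range (B i + s + 1))) (fun D => @ite κ (D i = 0) (Classical.dec _) (c (B + D) * Finset.prod (Finset.univ.erase i) (fun j => ((Nat.choose (B j + D j) (B j) : ℕ) : κ) * τ j ^ (D j))) 0); let step : Fin 1 → (Fin 1 → κ) → ((Fin 1 → ℕ) → κ) → ((Fin 1 → ℕ) → κ) := fun i τ c => clean (tr i τ (@ite ℕ (p ≤ ord (clean c)) (Classical.dec _) p 0) (dv i (@ite ℕ (p ≤ ord (clean c)) (Classical.dec _) p 0) (bl i (clean c)))); let run : ((Fin 1 → ℕ) → κ) → (ℕ → Fin 1) → (ℕ → Fin 1 → κ) → ℕ → ((Fin 1 → ℕ) → κ) := fun c₀ i t m => @Nat.rec (fun _ => (Fin 1 → ℕ) → κ) c₀ (fun m c => step (i m) (t m) c) m; let MultP : ((Fin 1 → ℕ) → κ) → Prop := fun c => (∃ A, clean c A ≠ 0) ∧ ∀ A, clean c A ≠ 0 → p ≤ Finset.sum Finset.univ (fun j => A j); 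
    ¬ (∀ m, MultP (run c₀ i t m)) := by
  intro clean bl ord dv tr step run MultP h
  -- Fin 1 bookkeeping
  have hU : ∀ (B : Fin 1 → ℕ) (j : Fin 1) (v : ℕ), Function.update B j v = fun _ => v := by
    intro B j v; funext k; rw [Subsingleton.elim k j, Function.update_self]
  have he : ∀ j : Fin 1, Finset.univ.erase j = (∅ : Finset (Fin 1)) := by
    intro j; ext k; simp [Subsingleton.elim k j]
  have hcleandef : ∀ (c : (Fin 1 → ℕ) → κ) A, clean c A = @ite κ (∀ j, p ∣ A j) (Classical.dec _) 0 (c A) :=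
    fun _ _ => rfl
  have hcc : ∀ (c : (Fin 1 → ℕ) → κ) A, clean (clean c) A = clean c A := by
    intro c A; rw [hcleandef, hcleandef c A]; split_ifs <;> rfl
  have hbl : ∀ (j : Fin 1) (c : (Fin 1 → ℕ) → κ) B, bl j c B = c B := by
    intro j c B
    show @ite κ (Finset.sum (Finset.univ.erase j) (fun k => B k) ≤ B j) (Classical.dec _)
        (c (Function.update B j (B j - Finset.sum (Finset.univ.erase j) (fun k => B k)))) 0 = c B
    rw [he j, Finset.sum_empty, if_pos (Nat.zero_le _), Nat.sub_zero, Function.update_eq_self]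
  have htr : ∀ (j : Fin 1) (τ : Fin 1 → κ) (s : ℕ) (c : (Fin 1 → ℕ) → κ) B, tr j τ s c B = c B := by
    intro j τ s c B
    show Finset.sum (Fintype.piFinset (fun _ : Fin 1 => Finset.range (B j + s + 1)))
        (fun D => @ite κ (D j = 0) (Classical.dec _)
          (c (B + D) * Finset.prod (Finset.univ.erase j)
            (fun k => ((Nat.choose (B k + D k) (B k) : ℕ) : κ) * τ k ^ (D k))) 0) = c B
    rw [Finset.sum_eq_single (0 : Fin 1 → ℕ)]
    · rw [if_pos (show (0 : Fin 1 → ℕ) j = 0 from rfl), he j, Finset.prod_empty, mul_one, add_zero]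
    · intro D _ hD
      rw [if_neg]
      intro hDj
      apply hD
      funext k; rw [Subsingleton.elim k j, hDj]; rfl
    · intro h0
      exact absurd (Fintype.mem_piFinset.mpr fun _ => Finset.mem_range.mpr (Nat.succ_pos _)) h0
  have hord : ∀ c : (Fin 1 → ℕ) → κ, MultP c → p ≤ ord (clean c) := by
    intro c hM
    obtain ⟨⟨A₀, hA₀⟩, hM2⟩ := hM
    show p ≤ sInf {m : ℕ | ∃ A, clean c A ≠ 0 ∧ m = Finset.sum Finset.univ (fun j => A j)}
    exact le_csInf ⟨Finset.sum Finset.univ (fun j => A₀ j), A₀, hA₀, rfl⟩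
      (by rintro m ⟨A, hA, rfl⟩; exact hM2 A hA)
  have hrun0 : run c₀ i t 0 = c₀ := rfl
  have hrunS : ∀ m, run c₀ i t (m + 1) = step (i m) (t m) (run c₀ i t m) := fun _ => rfl
  have hstepdef : ∀ (j : Fin 1) (τ : Fin 1 → κ) (c : (Fin 1 → ℕ) → κ), step j τ c =
      clean (tr j τ (@ite ℕ (p ≤ ord (clean c)) (Classical.dec _) p 0)
        (dv j (@ite ℕ (p ≤ ord (clean c)) (Classical.dec _) p 0) (bl j (clean c)))) := fun _ _ _ => rfl
  have hX : ∀ (j : Fin 1) (τ : Fin 1 → κ) (s : ℕ) (c : (Fin 1 → ℕ) → κ) (B : Fin 1 → ℕ),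
      tr j τ s (dv j s (bl j c)) B = c (Function.update B j (B j + s)) := by
    intro j τ s c B
    rw [htr]
    show bl j c (Function.update B j (B j + s)) = _
    rw [hbl]
  -- one step shifts the exponent by p
  have hshift : ∀ m B, clean (run c₀ i t (m + 1)) B =
      clean (run c₀ i t m) (Function.update B (i m) (B (i m) + p)) := by
    intro m B
    rw [hrunS, hstepdef, hcc, hcleandef, hX, if_pos (hord _ (h m))]
    by_cases hB : ∀ j, p ∣ B j
    · rw [if_pos hB, hcleandef, if_pos]
      intro j
      rw [Subsingleton.elim j (i m), Function.update_self]
      exact dvd_add (hB _) dvd_rfl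
    · rw [if_neg hB]
  have hg : ∀ m b, clean (run c₀ i t m) (fun _ => b) = clean c₀ (fun _ => b + p * m) := by
    intro m
    induction m with
    | zero => intro b; rw [hrun0, Nat.mul_zero, Nat.add_zero]
    | succ m ih =>
      intro b
      rw [hshift, hU, ih (b + p), show b + p + p * m = b + p * (m + 1) by ring]
  -- the contradiction
  have h0 : (∃ A, clean c₀ A ≠ 0) ∧ ∀ A, clean c₀ A ≠ 0 → p ≤ Finset.sum Finset.univ (fun j => A j) :=
    h 0
  obtain ⟨⟨A₀, hA₀⟩, -⟩ := h0
  have hA : A₀ = fun _ => A₀ 0 % p + p * (A₀ 0 / p) := by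
    funext k; rw [Subsingleton.elim k 0, Nat.mod_add_div]
  have hm : (∃ A, clean (run c₀ i t (A₀ 0 / p)) A ≠ 0) ∧
      ∀ A, clean (run c₀ i t (A₀ 0 / p)) A ≠ 0 → p ≤ Finset.sum Finset.univ (fun j => A j) :=
    h (A₀ 0 / p)
  have hne : clean (run c₀ i t (A₀ 0 / p)) (fun _ => A₀ 0 % p) ≠ 0 := by
    rw [hg, ← hA]; exact hA₀
  have hle := hm.2 _ hne
  rw [Fin.sum_univ_one] at hle
  exact absurd (Nat.mod_lt (A₀ 0) hp.pos) (not_lt.mpr hle)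


/-- **The hypothesis of `BoundedMilnor` is empty in dimension one** (exact shape of the crux
hypothesis, `n := 1`, all binders and instances of the crux): immediate from `noMultPRun_dim_one`.
So `BoundedMilnor` holds vacuously at `n = 1` and any refutation needs `n ≥ 2` (and, by
`Cruxes/BoundedMilnor/PROOF-T.md`, `p = 2`). [folklore] -/
theorem boundedMilnor_hypothesis_empty_dim_one (p : ℕ) (hp : p.Prime) (κ : Type) [Field κ]
    [CharP κ p] [PerfectField κ] (c₀ : (Fin 1 → ℕ) → κ) (i : ℕ → Fin 1) (t : ℕ → Fin 1 → κ) :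
    let clean : ((Fin 1 → ℕ) → κ) → ((Fin 1 → ℕ) → κ) := fun c A => @ite κ (∀ j, p ∣ A j) (Classical.dec _) 0 (c A); let bl : Fin 1 → ((Fin 1 → ℕ) → κ) → ((Fin 1 → ℕ) → κ) := fun i c B => @ite κ (Finset.sum (Finset.univ.erase i) (fun j => B j) ≤ B i) (Classical.dec _) (c (Function.update B i (B i - Finset.sum (Finset.univ.erase i) (fun j => B j)))) 0; let ord : ((Fin 1 → ℕ) → κ) → ℕ := fun c => sInf {m : ℕ | ∃ A, c A ≠ 0 ∧ m = Finset.sum Finset.univ (fun j => A j)}; let dv : Fin 1 → ℕ → ((Fin 1 → ℕ) → κ) → ((Fin 1 → ℕ) → κ) := fun i s c B => c (Function.update B i (B i + s)); let tr : Fin 1 → (Fin 1 → κ) → ℕ → ((Fin 1 → ℕ) → κ) → ((Fin 1 → ℕ) → κ) := fun i τ s c B => Finset.sum (Fintype.piFinset (fun _ : Fin 1 => Finset.range (B i + s + 1))) (fun D => @ite κ (D i = 0) (Classical.dec _) (c (B + D) * Finset.prod (Finset.univ.erase i) (fun j => ((Nat.choose (B j + D j) (B j) : ℕ) : κ) * τ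 j ^ (D j))) 0); let step : Fin 1 → (Fin 1 → κ) → ((Fin 1 → ℕ) → κ) → ((Fin 1 → ℕ) → κ) := fun i τ c => clean (tr i τ (@ite ℕ (p ≤ ord (clean c)) (Classical.dec _) p 0) (dv i (@ite ℕ (p ≤ ord (clean c)) (Classical.dec _) p 0) (bl i (clean c)))); let run : ((Fin 1 → ℕ) → κ) → (ℕ → Fin 1) → (ℕ → Fin 1 → κ) → ℕ → ((Fin 1 → ℕ) → κ) := fun c₀ i t m => @Nat.rec (fun _ => (Fin 1 → ℕ) → κ) c₀ (fun m c => step (i m) (t m) c) m; let ser : ((Fin 1 → ℕ) → κ) → MvPowerSeries (Fin 1) κ := fun c => show MvPowerSeries (Fin 1) κ from fun A : Fin 1 →₀ ℕ => clean c ⇑A; let pd : Fin 1 → MvPowerSeries (Fin 1) κ → MvPowerSeries (Fin 1) κ := fun i f => show MvPowerSeries (Fin 1) κ from fun A : Fin 1 →₀ ℕ => ((A i + 1 : ℕ) : κ) * f (A + Finsupp.single i 1); let jac : ((Fin 1 → ℕ) → κ) → Ideal (MvPowerSeries (Fin 1) κ) := fun c => Ideal.span (Set.range (fun i => pd i (ser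 c))); let Isol : ((Fin 1 → ℕ) → κ) → Prop := fun c => Module.Finite κ (MvPowerSeries (Fin 1) κ ⧸ jac c); let MultP : ((Fin 1 → ℕ) → κ) → Prop := fun c => (∃ A, clean c A ≠ 0) ∧ ∀ A, clean c A ≠ 0 → p ≤ Finset.sum Finset.univ (fun j => A j); 
    ¬ (∀ m, Isol (run c₀ i t m) ∧ MultP (run c₀ i t m)) := by
  intro clean bl ord dv tr step run ser pd jac Isol MultP h
  exact noMultPRun_dim_one p hp κ c₀ i t (fun m => (h m).2)

end Summit.ResolutionOfSingularities.ResolutionOfSingularities.Theorems.BoundedMilnor.Negative
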